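import Literature.MathematicalPhysics.QuantumFieldTheory.Balaban1983to89.Beta.RemainderHasMajGreenPrimeTowerDecayCoshWindow
import Literature.MathematicalPhysics.QuantumFieldTheory.Balaban1983to89.B9Eq324PenaltyBlockLocal

/-!
# T. Bałaban, *Propagators for lattice gauge theories in a background field*, Commun. Math. Phys. **99** (1985) 389–434
# [Balaban1985BackgroundPropagators] Thm 3.1 (3.42) for `G′_k(U)` AS THE `hG`-SHAPED `HasMaj` OF ROW (D4) — STOREY CLOSED IN THE SOCKET:
# (D-E)_k AND (D-P)_k INHABITED, `∃ (α₁, C, κ′)` BEFORE the height `n`, the volume `m` and the background `U` of print's diagonal window,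
# `HasMaj S_m S_m (G′_k(U)↾ℝ) (B⋆(d, a′, C, κ′)·e^{−κ′d_∞})` with `B⋆` a function of `(d, a′, C, κ′)` ALONE (the weights `c₀, c₁` CANCEL),
# modulo (T) for `U` and `hRlev` for the level averages; on the chain's class (unitary `U`, `*`-trace, compatible fibre norm) modulo `hRlev` ONLY

CITATION HEADER (lean-in-tree rule 2026-08-18).  Sources: [Balaban1985BackgroundPropagators] (B9; held
`paper:balaban1985-cmp99-background-propagators`, journal page = PDF page + 388): p. 397 Thm 3.1 *«There exist positive constants M₁, δ₀, a₀, B₀ dependent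
on d and L only … such that … |(G′(U)λ)(x)| … ≦ B₀e^{−δ₀d(y,y′)}|λ| for x ∈ Δ(y), y ∈ Λ_j, supp λ ⊂ Δ(y′)»* (3.42); p. 396 (3.35)–(3.37) (the small-field
window and the profile of the level averages); (3.24)–(3.25) p. 394 (`Δ′_a = Δ^η_U + Q′*aQ′`); (3.19) p. 393; (3.49) p. 399 (unit blocks); p. 416 Thm 3.11;
[Balaban1984PropagatorsI] (B5) p. 36; [Balaban1985Variational] (B11) (180) p. 306, (190) p. 308; [Balaban1984PropagatorsII] (B6) (2.51)–(2.52) p. 232;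
[Balaban1985Averaging] (18) p. 21.

WHY THIS FILE (audit cell `pub-balaban`, BINDER row (D4), OWNER lineage `b2b-balaban-beta-an4`, gen 109; «Y3f»).  `Beta.RemainderHasMajGreenPrimeTowerDecayCoshWindow`
(Y3e, this gen) inhabits the (D-E)_k letter of the k-uniform `hG` shape by ne9-leaf-03's `exists_block_decay_GpOfUk` and leaves (T), `hRlev`-free (D-P)_k `p₂`
displayed.  The (D-P)_k letter IS ne9-leaf-03 g69∕g70's `B9Eq324PenaltyBlockLocal` §2: on the diagonal `c₀(L^{n+1})^d = c₁`, for contractive LEVEL-average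
transporters (`hRlev`), `‖((Δ′_{a′,k}(U) − Δ^η_U)v)(x)‖ ≤ (|a′|∕√c₁)·‖1_{B^k(y)}v‖` for `x` over `y` (`norm_laplacePrimeAk_sub_covLaplace_apply_le_block_diagonal`,
fibre-predicate currency; `B9Eq342GreenPrimeTowerSupBoundDecay.bigBlock_eq_iff` is the dictionary to the socket's `Π = blockCoord (L^{n+1}) m ∘ siteCast`).
THIS FILE composes BY NAME:
* `hPS_fibre` — the (K1) big-block family in the fibre-predicate currency (`bigBlock_eq_iff` + `if_congr`; the NE9 OWNER's staged twin has the same two lines);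
* **`exists_hasMaj_GpOfUk_closed_sup`** — `∃ α₁ C κ′` (`0 < α₁`, `0 ≤ C`, `0 < κ′`, `2κ′ < 1∕√(4d+1)`) such that at EVERY height `n`, for EVERY period `m`,
  EVERY background of the window with contractive transporters of `U` ((T)) and of its level averages (`hRlev`), ANY positivity witness and EVERY big-block
  family `P`: `HasMaj S_m S_m ((e∘G′_k(U)∘e⁻¹)↾ℝ) (B⋆·e^{−κ′·d_∞})`, **`B⋆ = (1 + |a′|C)·2e^{1∕2}·Σ_{l<d}2^{l+1} + √(3^d·2^d)·√(2e^{1∕2}·K_d(1∕√(4d+1) − 2κ′))·C`** —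
  a function of `(d, a′, C, κ′)` ALONE: no `n`, `L`, `m`, `η`, `c₀`, `c₁`, `p₂`, `C_E`;
* **`exists_hasMaj_GpOfUk_closed`** — the same in the geometry's distance with the CLM packaging (the `hG` binder of
  `Beta.RemainderChartOriginDerivative.ineq190_fderiv_chartH179_zero_of_letters`, `δ₀ = κ′∕d`);
* **`exists_hasMaj_GpOfUk_closed_unitary`** — on the chain's class (unitary `U`, `*`-trace `τ`, fibre norm compatible with `τ`): (T) AND `hRS` struck (Y3e's
  `…_window_unitary` road); the ONLY displayed transporter letter is `hRlev` (the level averages `Ū^j` are not unitary; exactly as in `B9Eq324PenaltyBlockLocal` §2,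
  `B9Eq365QGGQLowerVariationalWindowTower`'s `hLb` and the NE9 OWNER's staged row-sum twin `B9Eq342GreenPrimeTowerSupBoundDecayClosed`).
Mechanism: Y3e at `p₂ := |a′|∕√c₁` with `hP` from `norm_laplacePrimeAk_sub_covLaplace_apply_le_block_diagonal` (∘ `hPS_fibre`, `bigBlock_eq_iff`), then
`B11SectG.HasMaj.mono` with the identity `(|a′|∕√c₁)·C·√c₁ = |a′|C`, `√(3^d∕c₁·2^d)·√c₁ = √(3^d·2^d)` (the NE9 OWNER's «weights cancelled» arithmetic of the staged
`…TowerSupBoundDecayPenalty.norm_GpOfUk_apply_le_rowSum_heightFree_penalty'`, re-run for the decay form).  [folklore] composition.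

HONEST SCOPE.  [folklore] bookkeeping; NO estimate of [5] is proved here (the (D-E)_k estimate is ne9-leaf-03's, (D-P)_k is ne9-leaf-03's, the row sum, the
weights and the height-free arithmetic are the NE9 OWNER's); the operator is [5] Thm 3.1's SITE operator `G′_k(U) = (Δ′_{a′,k}(U))⁻¹`, NOT Thm 3.3's BOND operator
`Δ_a⁻¹` of NODE D (Sect. C's random walk — the `Gaps/D4WalkBlock*` road; memo `FLAT-LETTERS-LOCATED.md` §19 (ii)); the rate `κ′` and the constant are the NE9 chain's
variational∕window sizes through `(α₁, C, ρ)`, NOT print's `δ₀, B₀`; the window letters (`hRS` off the unitary class, `U1`-membership of `U` and of the level averages,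
the profile `ε_j ≤ αr^j`, `‖U − 1‖ ≤ αη`) are print's running small-field axioms (3.35)–(3.37), DISPLAYED, and `hRlev` stays displayed on every class.  VALUE row
only (no ∇-row, no Hölder rows (3.40), no (3.43)–(3.47)).  Nothing identifies Bałaban's step objects (NODE O).  Row (D4) class UNCHANGED (instance 0∕1; D4
DISCHARGE NO DATE); NOT B12 Thm 2, NOT BetaPertH, NOT continuum, NOT Clay.  HONEST DEPENDENCY (cell line): continuum YM on T⁴ ⇐ BetaPertH ∧ nine spine estimates
(0/9 proved); BetaPertH ⇐ (D1) ∧ (D4) ∧ CAP+tail; G-an2-4 gates asym, D1 and NE2/3/4.  NEW file importing Y3e and `B9Eq324PenaltyBlockLocal`; nothing modified;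
0 `def`; standard axioms; no `sorry`.
-/

noncomputable section

open scoped BigOperators InnerProductSpace

namespace Literature.MathematicalPhysics.QuantumFieldTheory.Balaban1983to89.Beta.RemainderHasMajGreenPrimeTowerDecayCoshClosed

open B11SectG B11SupSize190
open B4Sect5Torus (TSite tdist)
open B4Sect5Proof (latticeConst latticeConst_nonneg)
open B5TorusCover (UT)
open B7Prop1Explicit (U1)
open B9Thm34Ext (toB6)
open B9Thm37GlueTorus (torusGeom)
open B9SectCLatticeCarrier (Bond)
open B9Eq311L2Pairing (WL2)
open B9Eq319QprimeTorus (fineP blockCoord)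
open B9Eq315QTower (towerP towerP_apply UlevOf)
open B9Eq316TowerFlatIsOneStep (towerP_eq_fineP_pow siteCast)
open B9Eq310HessianOperator (adTransportW)
open B11Eq103H1Complex (SiteL2K covLaplaceSiteK)
open B9Eq324DeltaPrimeATower (laplacePrimeAk GpOfUk)
open B9Eq342GreenPrimeTowerSupBoundDecay (bigBlock_eq_iff)
open B9Eq324PenaltyBlockLocal (norm_laplacePrimeAk_sub_covLaplace_apply_le_block_diagonal)
open Beta.RemainderHasMajGreenPrimeTowerDecayCoshWindow (exists_hasMaj_GpOfUk_window_sup exists_hasMaj_GpOfUk_window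
  exists_hasMaj_GpOfUk_window_unitary)

/-! ## §0 Bookkeeping: the big-block family in the fibre-predicate currency; the cancellation of the weights -/

section Fibre

variable {d : ℕ} (L : ℕ) (m : Fin d → ℕ) (n : ℕ) {W : Type} [NormedAddCommGroup W] [InnerProductSpace ℂ W] {c₀ : ℝ} [Fact (0 < c₀)]

/-- **THE (K1) BIG-BLOCK FAMILY IN THE FIBRE-PREDICATE CURRENCY**: a family `P_y` given pointwise by `Πx = y` is given pointwise by ne9-leaf-03's predicate
`∀ i, x_i ∕ L^{n+1} = y_i` (`bigBlock_eq_iff` + `if_congr`). [folklore] [cite: Balaban1985BackgroundPropagators, (3.19) p.393, (3.49) p.399] -/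
theorem hPS_fibre {PS : TSite d m → SiteL2K ℂ d (towerP L m (n + 1)) c₀ W →L[ℂ] SiteL2K ℂ d (towerP L m (n + 1)) c₀ W}
    (hPS : ∀ (y : TSite d m) (g : SiteL2K ℂ d (towerP L m (n + 1)) c₀ W) (x : TSite d (towerP L m (n + 1))),
      WL2.equiv ℂ (fun _ : TSite d (towerP L m (n + 1)) => c₀) W (PS y g) x =
        if blockCoord (L ^ (n + 1)) m (siteCast (towerP_eq_fineP_pow L m (n + 1)) x) = y then
          WL2.equiv ℂ (fun _ : TSite d (towerP L m (n + 1)) => c₀) W g x else 0)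
    (y : TSite d m) (g : SiteL2K ℂ d (towerP L m (n + 1)) c₀ W) (x : TSite d (towerP L m (n + 1))) :
    WL2.equiv ℂ (fun _ : TSite d (towerP L m (n + 1)) => c₀) W (PS y g) x =
      if (∀ i, (x i : ℕ) / L ^ (n + 1) = (y i : ℕ)) then WL2.equiv ℂ (fun _ : TSite d (towerP L m (n + 1)) => c₀) W g x else 0 := by
  rw [hPS]
  exact if_congr (bigBlock_eq_iff L m n x y) rfl rfl

end Fibre

/-- **THE WEIGHTS CANCEL** (`0 < c₁`): `(1 + (|a′|∕√c₁)·C·√c₁)·E·S + √(3^d∕c₁·2^d)·M·C·√c₁ = (1 + |a′|C)·E·S + √(3^d·2^d)·M·C` — the NE9 OWNER's arithmetic of the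
staged `…TowerSupBoundDecayPenalty.norm_GpOfUk_apply_le_rowSum_heightFree_penalty'`. [folklore] -/
private theorem const_weights_cancel (d : ℕ) {c₁ : ℝ} (hc₁ : 0 < c₁) (a' C E S M : ℝ) :
    (1 + |a'| * (Real.sqrt c₁)⁻¹ * C * Real.sqrt c₁) * E * S + Real.sqrt (3 ^ d / c₁ * 2 ^ d) * M * C * Real.sqrt c₁ =
      (1 + |a'| * C) * E * S + Real.sqrt (3 ^ d * 2 ^ d) * M * C := by
  have hs : Real.sqrt c₁ ≠ 0 := (Real.sqrt_pos.2 hc₁).ne'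
  have e1 : |a'| * (Real.sqrt c₁)⁻¹ * C * Real.sqrt c₁ = |a'| * C := by field_simp
  have e3 : Real.sqrt (3 ^ d / c₁ * 2 ^ d) * Real.sqrt c₁ = Real.sqrt (3 ^ d * 2 ^ d) := by
    rw [← Real.sqrt_mul (by positivity)]
    congr 1
    field_simp
  calc _ = (1 + |a'| * (Real.sqrt c₁)⁻¹ * C * Real.sqrt c₁) * E * S + (Real.sqrt (3 ^ d / c₁ * 2 ^ d) * Real.sqrt c₁) * M * C := by ring
    _ = _ := by rw [e1, e3]

section Closed

variable {d : ℕ} (L : ℕ) [NeZero L] {𝔸 : Type*} [NormedRing 𝔸] [NormedAlgebra ℂ 𝔸] [CompleteSpace 𝔸] [NormOneClass 𝔸]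
  {W : Type} [NormedAddCommGroup W] [InnerProductSpace ℂ W] [FiniteDimensional ℂ W] (φ : W ≃ₗ[ℂ] 𝔸) {a' Mφ Mφ' : ℝ}
  (hMφ : 0 ≤ Mφ) (hMφ' : 0 ≤ Mφ') (hφ : ∀ w, ‖φ w‖ ≤ Mφ * ‖w‖) (hφ' : ∀ X, ‖φ.symm X‖ ≤ Mφ' * ‖X‖) (ha' : 0 < a')
  {r : ℝ} (hr0 : 0 ≤ r) (hr1 : r < 1)

include hMφ hMφ' hφ hφ' ha' hr0 hr1 in
/-- **[5] THM 3.1 (3.42) AT EVERY HEIGHT AS `HasMaj S_m S_m (G′_k(U)↾ℝ) (B⋆·e^{−κ′·d_∞})`, (D-E)_k AND (D-P)_k INHABITED, `∃ (α₁, C, κ′)` BEFORE THE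
HEIGHT, THE VOLUME AND THE BACKGROUND** (`1 ≤ d`; given `L`, `M_φ, M_φ′`, `a′ > 0`, a profile ratio `r ∈ [0,1[`): at every height `n` on print's diagonal
(`ηL^{n+1} = 1`, `c₀(L^{n+1})^d = c₁`), for every period `m`, every background `U` of the window (`hRS`, `U(b) ∈ U1`, `‖U(b) − 1‖ ≤ αη`, `α ≤ α₁`, level
averages `‖Ū^j(b) − 1‖ ≤ ε_j ≤ αr^j` in `U1`) with contractive transporters of `U` ((T) `hR`, `hS`) and of the level averages (`hRlev`), ANY positivity
witness and every big-block family `P`, in the (190) sup sizes over ANY torus geometry: `HasMaj S_m S_m ((e∘G′_k(U)∘e⁻¹)↾ℝ) (B⋆·e^{−κ′·d_∞(y,v)})`,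
`B⋆ = (1 + |a′|C)·2e^{1∕2}·Σ_{l<d}2^{l+1} + √(3^d·2^d)·√(2e^{1∕2}·K_d(1∕√(4d+1) − 2κ′))·C` — a function of `(d, a′, C, κ′)` ALONE.
[cite: Balaban1985BackgroundPropagators, Thm 3.1 (3.42) p.397, (3.24) p.394, (3.35)–(3.37) p.396, (3.49) p.399, Thm 3.11 p.416]
[cite: Balaban1984PropagatorsI, p.36] [cite: Balaban1985Variational, (180) p.306, (190) p.308] [cite: Balaban1984PropagatorsII, (2.51)–(2.52) p.232] -/
theorem exists_hasMaj_GpOfUk_closed_sup (hd : 1 ≤ d) :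
    ∃ α₁ C κ' : ℝ, 0 < α₁ ∧ 0 ≤ C ∧ 0 < κ' ∧ 2 * κ' < Real.sqrt (1 / (4 * d + 1)) ∧
      ∀ (n : ℕ) (η : ℝ), η * (L : ℝ) ^ (n + 1) = 1 →
      ∀ (c₀ c₁ : ℝ) [Fact (0 < c₀)] [Fact (0 < c₁)], c₀ * ((L : ℝ) ^ (n + 1)) ^ d = c₁ →
      ∀ (m : Fin d → ℕ) [∀ i, NeZero (m i)] (U : Bond d (towerP L m (n + 1)) → 𝔸ˣ),
        (∀ (b : Bond d (towerP L m (n + 1))) (v u : W), ⟪adTransportW φ U b v, u⟫_ℂ = ⟪v, adTransportW φ (fun b => (U b)⁻¹) b u⟫_ℂ) →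
        (∀ (b : Bond d (towerP L m (n + 1))) (w : W), ‖adTransportW φ U b w‖ ≤ ‖w‖) →
        (∀ (b : Bond d (towerP L m (n + 1))) (w : W), ‖adTransportW φ (fun b => (U b)⁻¹) b w‖ ≤ ‖w‖) →
      ∀ (α : ℝ), 0 ≤ α → α ≤ α₁ → (∀ b, U b ∈ U1 𝔸) → (∀ b, ‖(U b : 𝔸) - 1‖ ≤ α * η) →
      ∀ (εU : ℕ → ℝ), (∀ j, 0 ≤ εU j) → (∀ j < n + 1, εU j ≤ α * r ^ j) →
        (∀ (j : ℕ) (b : Bond d (towerP L m (j + 1))), ‖(UlevOf L m (n + 1) U j b : 𝔸) - 1‖ ≤ εU j) →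
        (∀ (j : ℕ) (b : Bond d (towerP L m (j + 1))), UlevOf L m (n + 1) U j b ∈ U1 𝔸) →
        (∀ (j : ℕ) (b : Bond d (towerP L m (j + 1))) (w : W), ‖adTransportW φ (UlevOf L m (n + 1) U j) b w‖ ≤ ‖w‖) →
      ∀ (hpos' : ∀ x : SiteL2K ℂ d (towerP L m (n + 1)) c₀ W, x ≠ 0 → 0 < RCLike.re ⟪x, laplacePrimeAk L m n φ η U a' (c₁ := c₁) x⟫_ℂ)
        (PS : TSite d m → SiteL2K ℂ d (towerP L m (n + 1)) c₀ W →L[ℂ] SiteL2K ℂ d (towerP L m (n + 1)) c₀ W),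
        (∀ (y : TSite d m) (f : SiteL2K ℂ d (towerP L m (n + 1)) c₀ W) (x : TSite d (towerP L m (n + 1))),
          WL2.equiv ℂ (fun _ : TSite d (towerP L m (n + 1)) => c₀) W (PS y f) x =
            if blockCoord (L ^ (n + 1)) m (siteCast (towerP_eq_fineP_pow L m (n + 1)) x) = y then
              WL2.equiv ℂ (fun _ : TSite d (towerP L m (n + 1)) => c₀) W f x else 0) →
      ∀ (η₀ L₀ M₀ R : ℝ) (H : Prop),
        HasMaj
          (supSize (toB6 (torusGeom m η₀ L₀ M₀) R H)
            (fun y => Finset.univ.filter fun x : TSite d (towerP L m (n + 1)) =>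
              blockCoord (L ^ (n + 1)) m (siteCast (towerP_eq_fineP_pow L m (n + 1)) x) = UT.toSite m y)
            (fun x => UT.ofSite m (blockCoord (L ^ (n + 1)) m (siteCast (towerP_eq_fineP_pow L m (n + 1)) x))) :
              BlockNorm (toB6 (torusGeom m η₀ L₀ M₀) R H) (TSite d (towerP L m (n + 1)) → W))
          (supSize (toB6 (torusGeom m η₀ L₀ M₀) R H)
            (fun y => Finset.univ.filter fun x : TSite d (towerP L m (n + 1)) =>
              blockCoord (L ^ (n + 1)) m (siteCast (towerP_eq_fineP_pow L m (n + 1)) x) = UT.toSite m y)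
            (fun x => UT.ofSite m (blockCoord (L ^ (n + 1)) m (siteCast (towerP_eq_fineP_pow L m (n + 1)) x))))
          (((WL2.linearEquiv ℂ ℂ (fun _ : TSite d (towerP L m (n + 1)) => c₀) :
                SiteL2K ℂ d (towerP L m (n + 1)) c₀ W ≃ₗ[ℂ] (TSite d (towerP L m (n + 1)) → W)).toLinearMap ∘ₗ
              GpOfUk L m n φ η U a' (c₁ := c₁) hpos' ∘ₗ
              (WL2.linearEquiv ℂ ℂ (fun _ : TSite d (towerP L m (n + 1)) => c₀) :
                SiteL2K ℂ d (towerP L m (n + 1)) c₀ W ≃ₗ[ℂ] (TSite d (towerP L m (n + 1)) → W)).symm.toLinearMap).restrictScalars ℝ)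
          (fun y v => ((1 + |a'| * C) * (Real.exp (1 / 2) * 2) * (∑ l ∈ Finset.range d, (2 : ℝ) ^ (l + 1)) +
              Real.sqrt (3 ^ d * 2 ^ d) * Real.sqrt ((Real.exp (1 / 2) * 2) * latticeConst d (Real.sqrt (1 / (4 * d + 1)) - 2 * κ')) * C) *
            Real.exp (-(κ' * tdist m (UT.toSite m y) (UT.toSite m v)))) := by
  obtain ⟨α₁, C, κ', hα₁, hC, hκ'0, h2κ, hAll⟩ := exists_hasMaj_GpOfUk_window_sup L φ (a' := a') hMφ hMφ' hφ hφ' ha' hr0 hr1 hd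
  refine ⟨α₁, C, κ', hα₁, hC, hκ'0, h2κ, ?_⟩
  intro n η hηL c₀ c₁ _ _ hdiag m _ U hRS hR hS α hα hαle hUb hUε εU hεU hεg hLε hLb hRlev hpos' PS hPS η₀ L₀ M₀ R H
  have hc₁ : 0 < c₁ := Fact.out
  have hPS' := hPS_fibre L m n hPS
  -- (D-P)_k with `p₂ = |a′|∕√c₁` (ne9-leaf-03's (D) §2 on the diagonal), read in the socket's `Π`-currency
  have hP : ∀ (v : SiteL2K ℂ d (towerP L m (n + 1)) c₀ W) (x : TSite d (towerP L m (n + 1))),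
      ‖WL2.equiv ℂ _ W (laplacePrimeAk L m n φ η U a' (c₁ := c₁) v -
        covLaplaceSiteK ((η : ℂ))⁻¹ (adTransportW φ U) (adTransportW φ fun b => (U b)⁻¹) v) x‖ ≤
        |a'| * (Real.sqrt c₁)⁻¹ * ‖PS (blockCoord (L ^ (n + 1)) m (siteCast (towerP_eq_fineP_pow L m (n + 1)) x)) v‖ := fun v x =>
    norm_laplacePrimeAk_sub_covLaplace_apply_le_block_diagonal L m n φ U (hP := hPS') (hRlev := hRlev) hdiag η a' v x _
      ((bigBlock_eq_iff L m n x _).1 rfl)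
  have h := hAll n η hηL c₀ c₁ hdiag m U hRS hR hS α hα hαle hUb hUε εU hεU hεg hLε hLb hpos' PS hPS (|a'| * (Real.sqrt c₁)⁻¹) (by positivity)
    hP η₀ L₀ M₀ R H
  exact h.mono fun y v => le_of_eq (by rw [const_weights_cancel d hc₁])


include hMφ hMφ' hφ hφ' ha' hr0 hr1 in
/-- **THE SAME IN THE GEOMETRY's OWN DISTANCE, OPERATOR AS A CONTINUOUS LINEAR MAP** (`δ₀ = κ′∕d`): the `hG` binder of
`Beta.RemainderChartOriginDerivative.ineq190_fderiv_chartH179_zero_of_letters` at every height with `∃ (α₁, C, κ′)` before the height, the volume and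
the background of the window; (D-E)_k and (D-P)_k inhabited; (T) and `hRlev` displayed.
[cite: Balaban1985BackgroundPropagators, Thm 3.1 (3.42) p.397, (3.24) p.394, (3.35)–(3.37) p.396] [cite: Balaban1985Variational, (180) p.306, (182) p.307, (190) p.308]
[cite: Balaban1984PropagatorsII, (2.51)–(2.52) p.232, (2.54) p.233] -/
theorem exists_hasMaj_GpOfUk_closed (hd : 1 ≤ d) :
    ∃ α₁ C κ' : ℝ, 0 < α₁ ∧ 0 ≤ C ∧ 0 < κ' ∧ 2 * κ' < Real.sqrt (1 / (4 * d + 1)) ∧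
      ∀ (n : ℕ) (η : ℝ), η * (L : ℝ) ^ (n + 1) = 1 →
      ∀ (c₀ c₁ : ℝ) [Fact (0 < c₀)] [Fact (0 < c₁)], c₀ * ((L : ℝ) ^ (n + 1)) ^ d = c₁ →
      ∀ (m : Fin d → ℕ) [∀ i, NeZero (m i)] (U : Bond d (towerP L m (n + 1)) → 𝔸ˣ),
        (∀ (b : Bond d (towerP L m (n + 1))) (v u : W), ⟪adTransportW φ U b v, u⟫_ℂ = ⟪v, adTransportW φ (fun b => (U b)⁻¹) b u⟫_ℂ) →
        (∀ (b : Bond d (towerP L m (n + 1))) (w : W), ‖adTransportW φ U b w‖ ≤ ‖w‖) →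
        (∀ (b : Bond d (towerP L m (n + 1))) (w : W), ‖adTransportW φ (fun b => (U b)⁻¹) b w‖ ≤ ‖w‖) →
      ∀ (α : ℝ), 0 ≤ α → α ≤ α₁ → (∀ b, U b ∈ U1 𝔸) → (∀ b, ‖(U b : 𝔸) - 1‖ ≤ α * η) →
      ∀ (εU : ℕ → ℝ), (∀ j, 0 ≤ εU j) → (∀ j < n + 1, εU j ≤ α * r ^ j) →
        (∀ (j : ℕ) (b : Bond d (towerP L m (j + 1))), ‖(UlevOf L m (n + 1) U j b : 𝔸) - 1‖ ≤ εU j) →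
        (∀ (j : ℕ) (b : Bond d (towerP L m (j + 1))), UlevOf L m (n + 1) U j b ∈ U1 𝔸) →
        (∀ (j : ℕ) (b : Bond d (towerP L m (j + 1))) (w : W), ‖adTransportW φ (UlevOf L m (n + 1) U j) b w‖ ≤ ‖w‖) →
      ∀ (hpos' : ∀ x : SiteL2K ℂ d (towerP L m (n + 1)) c₀ W, x ≠ 0 → 0 < RCLike.re ⟪x, laplacePrimeAk L m n φ η U a' (c₁ := c₁) x⟫_ℂ)
        (PS : TSite d m → SiteL2K ℂ d (towerP L m (n + 1)) c₀ W →L[ℂ] SiteL2K ℂ d (towerP L m (n + 1)) c₀ W),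
        (∀ (y : TSite d m) (f : SiteL2K ℂ d (towerP L m (n + 1)) c₀ W) (x : TSite d (towerP L m (n + 1))),
          WL2.equiv ℂ (fun _ : TSite d (towerP L m (n + 1)) => c₀) W (PS y f) x =
            if blockCoord (L ^ (n + 1)) m (siteCast (towerP_eq_fineP_pow L m (n + 1)) x) = y then
              WL2.equiv ℂ (fun _ : TSite d (towerP L m (n + 1)) => c₀) W f x else 0) →
      ∀ (η₀ L₀ M₀ R : ℝ) (H : Prop),
        HasMaj
          (supSize (toB6 (torusGeom m η₀ L₀ M₀) R H)
            (fun y => Finset.univ.filter fun x : TSite d (towerP L m (n + 1)) =>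
              blockCoord (L ^ (n + 1)) m (siteCast (towerP_eq_fineP_pow L m (n + 1)) x) = UT.toSite m y)
            (fun x => UT.ofSite m (blockCoord (L ^ (n + 1)) m (siteCast (towerP_eq_fineP_pow L m (n + 1)) x))) :
              BlockNorm (toB6 (torusGeom m η₀ L₀ M₀) R H) (TSite d (towerP L m (n + 1)) → W))
          (supSize (toB6 (torusGeom m η₀ L₀ M₀) R H)
            (fun y => Finset.univ.filter fun x : TSite d (towerP L m (n + 1)) =>
              blockCoord (L ^ (n + 1)) m (siteCast (towerP_eq_fineP_pow L m (n + 1)) x) = UT.toSite m y)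
            (fun x => UT.ofSite m (blockCoord (L ^ (n + 1)) m (siteCast (towerP_eq_fineP_pow L m (n + 1)) x))))
          (((LinearMap.toContinuousLinearMap
              ((WL2.linearEquiv ℂ ℂ (fun _ : TSite d (towerP L m (n + 1)) => c₀) :
                  SiteL2K ℂ d (towerP L m (n + 1)) c₀ W ≃ₗ[ℂ] (TSite d (towerP L m (n + 1)) → W)).toLinearMap ∘ₗ
                GpOfUk L m n φ η U a' (c₁ := c₁) hpos' ∘ₗ
                (WL2.linearEquiv ℂ ℂ (fun _ : TSite d (towerP L m (n + 1)) => c₀) :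
                  SiteL2K ℂ d (towerP L m (n + 1)) c₀ W ≃ₗ[ℂ] (TSite d (towerP L m (n + 1)) → W)).symm.toLinearMap)).restrictScalars ℝ :
              (TSite d (towerP L m (n + 1)) → W) →ₗ[ℝ] (TSite d (towerP L m (n + 1)) → W)))
          (fun y v => ((1 + |a'| * C) * (Real.exp (1 / 2) * 2) * (∑ l ∈ Finset.range d, (2 : ℝ) ^ (l + 1)) +
              Real.sqrt (3 ^ d * 2 ^ d) * Real.sqrt ((Real.exp (1 / 2) * 2) * latticeConst d (Real.sqrt (1 / (4 * d + 1)) - 2 * κ')) * C) *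
            Real.exp (-(κ' / d * (toB6 (torusGeom m η₀ L₀ M₀) R H).dist y v))) := by
  obtain ⟨α₁, C, κ', hα₁, hC, hκ'0, h2κ, hAll⟩ := exists_hasMaj_GpOfUk_window L φ (a' := a') hMφ hMφ' hφ hφ' ha' hr0 hr1 hd
  refine ⟨α₁, C, κ', hα₁, hC, hκ'0, h2κ, ?_⟩
  intro n η hηL c₀ c₁ _ _ hdiag m _ U hRS hR hS α hα hαle hUb hUε εU hεU hεg hLε hLb hRlev hpos' PS hPS η₀ L₀ M₀ R H
  have hc₁ : 0 < c₁ := Fact.out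
  have hPS' := hPS_fibre L m n hPS
  -- (D-P)_k with `p₂ = |a′|∕√c₁` (ne9-leaf-03's (D) §2 on the diagonal), read in the socket's `Π`-currency
  have hP : ∀ (v : SiteL2K ℂ d (towerP L m (n + 1)) c₀ W) (x : TSite d (towerP L m (n + 1))),
      ‖WL2.equiv ℂ _ W (laplacePrimeAk L m n φ η U a' (c₁ := c₁) v -
        covLaplaceSiteK ((η : ℂ))⁻¹ (adTransportW φ U) (adTransportW φ fun b => (U b)⁻¹) v) x‖ ≤
        |a'| * (Real.sqrt c₁)⁻¹ * ‖PS (blockCoord (L ^ (n + 1)) m (siteCast (towerP_eq_fineP_pow L m (n + 1)) x)) v‖ := fun v x =>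
    norm_laplacePrimeAk_sub_covLaplace_apply_le_block_diagonal L m n φ U (hP := hPS') (hRlev := hRlev) hdiag η a' v x _
      ((bigBlock_eq_iff L m n x _).1 rfl)
  have h := hAll n η hηL c₀ c₁ hdiag m U hRS hR hS α hα hαle hUb hUε εU hεU hεg hLε hLb hpos' PS hPS (|a'| * (Real.sqrt c₁)⁻¹) (by positivity)
    hP η₀ L₀ M₀ R H
  exact h.mono fun y v => le_of_eq (by rw [const_weights_cancel d hc₁])


end Closed

/-! ## The chain's class: unitary `U`, `*`-trace, compatible fibre norm — (T) AND `hRS` inhabited; `hRlev` the only displayed transporter letter -/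

section Unitary

variable {d : ℕ} (L : ℕ) [NeZero L] {𝔸 : Type*} [NormedRing 𝔸] [StarRing 𝔸] [NormedAlgebra ℂ 𝔸] [CompleteSpace 𝔸] [NormOneClass 𝔸]
  {W : Type} [NormedAddCommGroup W] [InnerProductSpace ℂ W] [FiniteDimensional ℂ W] (φ : W ≃ₗ[ℂ] 𝔸) {a' Mφ Mφ' : ℝ}
  (hMφ : 0 ≤ Mφ) (hMφ' : 0 ≤ Mφ') (hφ : ∀ w, ‖φ w‖ ≤ Mφ * ‖w‖) (hφ' : ∀ X, ‖φ.symm X‖ ≤ Mφ' * ‖X‖) (ha' : 0 < a')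
  {r : ℝ} (hr0 : 0 ≤ r) (hr1 : r < 1)
  (τ : 𝔸 →ₗ[ℂ] ℂ) (hτ₂ : ∀ X Y : 𝔸, τ (X * Y) = τ (Y * X)) (hφτ : ∀ X Y : 𝔸, ⟪φ.symm X, φ.symm Y⟫_ℂ = τ (star X * Y))

include hMφ hMφ' hφ hφ' ha' hr0 hr1 hτ₂ hφτ in
/-- **ON THE CHAIN's CLASS: `∃ (α₁, C, κ′)` BEFORE THE HEIGHT, THE VOLUME AND THE BACKGROUND; (D-E)_k, (D-P)_k, (T) AND `hRS` INHABITED; THE ONLY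
DISPLAYED TRANSPORTER LETTER IS `hRlev`** — unitary `U` (`star U(b) = U(b)⁻¹`), a `*`-trace `τ`, the fibre norm compatible with `τ` ([B7] (18)); what remains
displayed is the window ((3.35)–(3.37): `U1`-membership of `U` and of the level averages, `‖U(b) − 1‖ ≤ αη`, `ε_j ≤ αr^j`), the contraction of the LEVEL-average
transporters `hRlev`, ANY positivity witness and the big-block family.  Conclusion: the geometry-distance CLM form with `B⋆(d, a′, C, κ′)`.
[cite: Balaban1985BackgroundPropagators, Thm 3.1 (3.42) p.397, (3.39) p.397, (3.8) p.392, (3.24) p.394, (3.35)–(3.37) p.396] [cite: Balaban1985Averaging, (18) p.21]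
[cite: Balaban1985Variational, (180) p.306, (190) p.308] -/
theorem exists_hasMaj_GpOfUk_closed_unitary (hd : 1 ≤ d) :
    ∃ α₁ C κ' : ℝ, 0 < α₁ ∧ 0 ≤ C ∧ 0 < κ' ∧ 2 * κ' < Real.sqrt (1 / (4 * d + 1)) ∧
      ∀ (n : ℕ) (η : ℝ), η * (L : ℝ) ^ (n + 1) = 1 →
      ∀ (c₀ c₁ : ℝ) [Fact (0 < c₀)] [Fact (0 < c₁)], c₀ * ((L : ℝ) ^ (n + 1)) ^ d = c₁ →
      ∀ (m : Fin d → ℕ) [∀ i, NeZero (m i)] (U : Bond d (towerP L m (n + 1)) → 𝔸ˣ),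
        (∀ b, star (U b : 𝔸) = ((U b)⁻¹ : 𝔸ˣ)) →
      ∀ (α : ℝ), 0 ≤ α → α ≤ α₁ → (∀ b, U b ∈ U1 𝔸) → (∀ b, ‖(U b : 𝔸) - 1‖ ≤ α * η) →
      ∀ (εU : ℕ → ℝ), (∀ j, 0 ≤ εU j) → (∀ j < n + 1, εU j ≤ α * r ^ j) →
        (∀ (j : ℕ) (b : Bond d (towerP L m (j + 1))), ‖(UlevOf L m (n + 1) U j b : 𝔸) - 1‖ ≤ εU j) →
        (∀ (j : ℕ) (b : Bond d (towerP L m (j + 1))), UlevOf L m (n + 1) U j b ∈ U1 𝔸) →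
        (∀ (j : ℕ) (b : Bond d (towerP L m (j + 1))) (w : W), ‖adTransportW φ (UlevOf L m (n + 1) U j) b w‖ ≤ ‖w‖) →
      ∀ (hpos' : ∀ x : SiteL2K ℂ d (towerP L m (n + 1)) c₀ W, x ≠ 0 → 0 < RCLike.re ⟪x, laplacePrimeAk L m n φ η U a' (c₁ := c₁) x⟫_ℂ)
        (PS : TSite d m → SiteL2K ℂ d (towerP L m (n + 1)) c₀ W →L[ℂ] SiteL2K ℂ d (towerP L m (n + 1)) c₀ W),
        (∀ (y : TSite d m) (f : SiteL2K ℂ d (towerP L m (n + 1)) c₀ W) (x : TSite d (towerP L m (n + 1))),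
          WL2.equiv ℂ (fun _ : TSite d (towerP L m (n + 1)) => c₀) W (PS y f) x =
            if blockCoord (L ^ (n + 1)) m (siteCast (towerP_eq_fineP_pow L m (n + 1)) x) = y then
              WL2.equiv ℂ (fun _ : TSite d (towerP L m (n + 1)) => c₀) W f x else 0) →
      ∀ (η₀ L₀ M₀ R : ℝ) (H : Prop),
        HasMaj
          (supSize (toB6 (torusGeom m η₀ L₀ M₀) R H)
            (fun y => Finset.univ.filter fun x : TSite d (towerP L m (n + 1)) =>
              blockCoord (L ^ (n + 1)) m (siteCast (towerP_eq_fineP_pow L m (n + 1)) x) = UT.toSite m y)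
            (fun x => UT.ofSite m (blockCoord (L ^ (n + 1)) m (siteCast (towerP_eq_fineP_pow L m (n + 1)) x))) :
              BlockNorm (toB6 (torusGeom m η₀ L₀ M₀) R H) (TSite d (towerP L m (n + 1)) → W))
          (supSize (toB6 (torusGeom m η₀ L₀ M₀) R H)
            (fun y => Finset.univ.filter fun x : TSite d (towerP L m (n + 1)) =>
              blockCoord (L ^ (n + 1)) m (siteCast (towerP_eq_fineP_pow L m (n + 1)) x) = UT.toSite m y)
            (fun x => UT.ofSite m (blockCoord (L ^ (n + 1)) m (siteCast (towerP_eq_fineP_pow L m (n + 1)) x))))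
          (((LinearMap.toContinuousLinearMap
              ((WL2.linearEquiv ℂ ℂ (fun _ : TSite d (towerP L m (n + 1)) => c₀) :
                  SiteL2K ℂ d (towerP L m (n + 1)) c₀ W ≃ₗ[ℂ] (TSite d (towerP L m (n + 1)) → W)).toLinearMap ∘ₗ
                GpOfUk L m n φ η U a' (c₁ := c₁) hpos' ∘ₗ
                (WL2.linearEquiv ℂ ℂ (fun _ : TSite d (towerP L m (n + 1)) => c₀) :
                  SiteL2K ℂ d (towerP L m (n + 1)) c₀ W ≃ₗ[ℂ] (TSite d (towerP L m (n + 1)) → W)).symm.toLinearMap)).restrictScalars ℝ :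
              (TSite d (towerP L m (n + 1)) → W) →ₗ[ℝ] (TSite d (towerP L m (n + 1)) → W)))
          (fun y v => ((1 + |a'| * C) * (Real.exp (1 / 2) * 2) * (∑ l ∈ Finset.range d, (2 : ℝ) ^ (l + 1)) +
              Real.sqrt (3 ^ d * 2 ^ d) * Real.sqrt ((Real.exp (1 / 2) * 2) * latticeConst d (Real.sqrt (1 / (4 * d + 1)) - 2 * κ')) * C) *
            Real.exp (-(κ' / d * (toB6 (torusGeom m η₀ L₀ M₀) R H).dist y v))) := by
  obtain ⟨α₁, C, κ', hα₁, hC, hκ'0, h2κ, hAll⟩ := exists_hasMaj_GpOfUk_window_unitary L φ (a' := a') hMφ hMφ' hφ hφ' ha' hr0 hr1 τ hτ₂ hφτ hd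
  refine ⟨α₁, C, κ', hα₁, hC, hκ'0, h2κ, ?_⟩
  intro n η hηL c₀ c₁ _ _ hdiag m _ U hU α hα hαle hUb hUε εU hεU hεg hLε hLb hRlev hpos' PS hPS η₀ L₀ M₀ R H
  have hc₁ : 0 < c₁ := Fact.out
  have hPS' := hPS_fibre L m n hPS
  have hP : ∀ (v : SiteL2K ℂ d (towerP L m (n + 1)) c₀ W) (x : TSite d (towerP L m (n + 1))),
      ‖WL2.equiv ℂ _ W (laplacePrimeAk L m n φ η U a' (c₁ := c₁) v -
        covLaplaceSiteK ((η : ℂ))⁻¹ (adTransportW φ U) (adTransportW φ fun b => (U b)⁻¹) v) x‖ ≤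
        |a'| * (Real.sqrt c₁)⁻¹ * ‖PS (blockCoord (L ^ (n + 1)) m (siteCast (towerP_eq_fineP_pow L m (n + 1)) x)) v‖ := fun v x =>
    norm_laplacePrimeAk_sub_covLaplace_apply_le_block_diagonal L m n φ U (hP := hPS') (hRlev := hRlev) hdiag η a' v x _
      ((bigBlock_eq_iff L m n x _).1 rfl)
  have h := hAll n η hηL c₀ c₁ hdiag m U hU α hα hαle hUb hUε εU hεU hεg hLε hLb hpos' PS hPS (|a'| * (Real.sqrt c₁)⁻¹) (by positivity)
    hP η₀ L₀ M₀ R H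
  exact h.mono fun y v => le_of_eq (by rw [const_weights_cancel d hc₁])


end Unitary

end Literature.MathematicalPhysics.QuantumFieldTheory.Balaban1983to89.Beta.RemainderHasMajGreenPrimeTowerDecayCoshClosed

end
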